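import Summits.Ventures.HSemireg.WedgeHankelConfluentPoint

/-!
# Venture HSemireg — THE TWO-NODE CONFLUENT KERNEL LAW (nodes `0` and `∞`): a class `Σ_{p≤P} q_p Θ^p/p! + (top window of length P′+1)` with
# `q_P ≠ 0 ≠ q_{n−P′}` has kernel `SI_k ⊕ (forms with more than P x-letters AND more than P′ y-letters)` in every degree `k ≤ n − P − P′ − 1`

HONEST FRAMING. Part of the Lean index of the computation cell `pub-hsemireg` (seat p10 gen 15, Sunday typer «UNIFORM-IN-n»).
Finite-dimensional EXTERIOR ALGEBRA over a field ONLY: no variety, no cohomology theory, no sheaf, no Ext group, no semiregularity map;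
nothing here says that HC / HC_CM / HC_AV holds; no Literature fact is declared or used.  Custodian versions as in `WedgeHankelSiegelIdeal` (1/3)
and `WedgeHankelConfluent`; the dictionary (`Θ^p/p! ↦ E_p`; the top window ↦ an order-`(P′+1)` node at `∞`; `plane(a,b) ↔ H^b(⋀^a T)`) is QUOTED, never asserted.

WHAT IS IN THE TREE / KEYED.  Gen 15 E3/E4 (`WedgeHankelConfluent`, `…Point`): ONE node of any order, at `0` resp. `∞`.  Gen 13/14: the point PLUS exponentials
of distinct slopes (`Kr_w_exp_add_point`: `F_λ(k) ∩ F_∞(k)`; `Kr_w_psecSeq`), all nodes SIMPLE.  THIS FILE (continues namespace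
`Summit.Ventures.HSemireg.Wedge.HankelSiegelIdeal`; imports E4): TWO nodes WITH multiplicities, at `0` and at `∞`:
* §34 `xyRich n k P P′ := Σ_{P < a, P′ < k−a} plane(a, k−a)` — more than `P` x-letters AND more than `P′` y-letters; it kills every class supported on
  `[0,P] ∪ [n−P′, n]` (zero windows), and so does `SI_k ⊔ xyRich`.
* §35 THE TWO INDUCTIONS: if `q_j = 0` for `P < j < n − P′`, `q_P ≠ 0`, `q_{n−P′} ≠ 0`, `k + P + P′ + 1 ≤ n` and `θ ∧ w_n(q) = 0` (`θ ∈ ⋀^k`), then the components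
  of `θ` with at most `P` x-letters (`prj_mem_siegelIdeal_of_two_nodes`) and those with at most `P′` y-letters (`prjY_mem_siegelIdeal_of_two_nodes`)
  are isotropic — E3's / E4's projections, the other node's terms never reaching the projected block because `k + P + P′ < n`.
* §36 **THE TWO-NODE CONFLUENT KERNEL LAW `Kr_w_eq_of_two_orders`: `Kr(univ, w_n(q), k) = SI_k ⊔ xyRich(k, P, P′)`**; it depends only on `(P, P′)`
  (`Kr_w_eq_Kr_w_of_two_orders`); `P = P′ = 0` (pure at `0` plus the point): `Kr = xyRich(k,0,0)` EXACTLY — the forms with an x- and a y-letter, gen 13's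
  `F_0(k) ∩ F_∞(k)` recovered (`Kr_w_pure_add_point`).
NOT typed here: two FINITE nodes `λ ≠ μ` (transport by E5's shear and its swap-conjugate — sequel), three or more nodes, the degrees `k ≥ n − P − P′`;
anything Ext-side.  Class side only.
-/

open Module

namespace Summit.Ventures.HSemireg.Wedge.HankelSiegelIdeal

open Summit.Ventures.HSemireg.Wedge Summit.Ventures.HSemireg.Wedge.Hankel
  Summit.Ventures.HSemireg.Wedge.HankelSiegel Summit.Ventures.HSemireg.Wedge.KunnethKernel

variable (K : Type*) [Field K] {n : ℕ}

/-! ## §34. Forms with more than `P` x-letters and more than `P′` y-letters -/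

/-- **`xyRich n k P P′ := Σ_{P < a ≤ k, P′ < k − a} plane(a, k−a)`** — the degree-`k` forms all of whose monomials have MORE THAN `P` x-letters AND MORE THAN
`P′` y-letters. -/
noncomputable def xyRich (n k P P' : ℕ) : Submodule K (HT K (In n)) :=
  ⨆ a ∈ (Finset.Ioc P k).filter (fun a => P' < k - a), plane K n a (k - a)

/-- `xyRich ⊆ ⋀^k`. -/
theorem xyRich_le_exteriorPower (k P P' : ℕ) : xyRich K n k P P' ≤ ⋀[K]^k (In n → K) := by
  refine iSup₂_le fun a ha => ?_
  rw [Finset.mem_filter, Finset.mem_Ioc] at ha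
  have := plane_le_exteriorPower K (n := n) a (k - a)
  rwa [show a + (k - a) = k by omega] at this

/-- a block with more than `P` x-letters and more than `P′` y-letters lies in `xyRich`. -/
lemma plane_le_xyRich {k P P' a : ℕ} (ha : P < a) (hak : a ≤ k) (hb : P' < k - a) : plane K n a (k - a) ≤ xyRich K n k P P' :=
  le_iSup₂_of_le (f := fun a _ => plane K n a (k - a)) a (Finset.mem_filter.mpr ⟨Finset.mem_Ioc.mpr ⟨ha, hak⟩, hb⟩) le_rfl

/-- `xyRich ≤ xRich` and `xyRich ≤ yRich`. -/
lemma xyRich_le (k P P' : ℕ) : xyRich K n k P P' ≤ xRich K n k P ⊓ yRich K n k P' := by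
  refine iSup₂_le fun a ha => ?_
  rw [Finset.mem_filter, Finset.mem_Ioc] at ha
  refine le_inf (plane_le_xRich K ha.1.1 ha.1.2) ?_
  have := plane_le_yRich K (n := n) (k := k) (P := P') (b := k - a) ha.2 (by omega)
  rwa [show k - (k - a) = a by omega] at this

/-- **`xyRich` KILLS EVERY CLASS SUPPORTED ON `[0, P] ∪ [n − P′, n]`** (`k ≤ n`): every window of such a block lies strictly between the two supports. -/
theorem mul_w_eq_zero_of_mem_xyRich {k P P' : ℕ} (hk : k ≤ n) {q : ℕ → K} (hq : ∀ j, P < j → j < n - P' → q j = 0) {θ : HT K (In n)}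
    (hθ : θ ∈ xyRich K n k P P') : θ * w K n n q = 0 := by
  have h : xyRich K n k P P' ≤ LinearMap.ker (LinearMap.mulRight K (w K n n q)) := by
    refine iSup₂_le fun a ha => fun x hx => ?_
    rw [Finset.mem_filter, Finset.mem_Ioc] at ha
    rw [LinearMap.mem_ker, LinearMap.mulRight_apply]
    exact plane_mul_w_eq_zero_of_window K (by omega) (fun s hs => hq _ (by omega) (by omega)) hx
  have := h hθ
  rwa [LinearMap.mem_ker, LinearMap.mulRight_apply] at this

/-- **`SI_k ⊔ xyRich` kills every class supported on `[0, P] ∪ [n − P′, n]`** (`k ≤ n`). -/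
theorem mul_w_eq_zero_of_mem_sup_two {k P P' : ℕ} (hk : k ≤ n) {q : ℕ → K} (hq : ∀ j, P < j → j < n - P' → q j = 0) {θ : HT K (In n)}
    (hθ : θ ∈ siegelIdeal K n k ⊔ xyRich K n k P P') : θ * w K n n q = 0 := by
  obtain ⟨y, hy, z, hz, rfl⟩ := Submodule.mem_sup.mp hθ
  rw [add_mul, mul_w_eq_zero_of_mem_siegelIdeal K hy q, mul_w_eq_zero_of_mem_xyRich K hk hq hz, add_zero]

/-! ## §35. The two inductions -/

/-- **LOW NODE**: under the two-node hypotheses, every component `prj a (k−a) θ` with `a ≤ P` of a form killing the class is isotropic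
(the top node's terms never reach the projected block since `k + P + P′ < n`). -/
theorem prj_mem_siegelIdeal_of_two_nodes {k P P' : ℕ} (hkP : k + P + P' + 1 ≤ n) {q : ℕ → K} (hq : ∀ j, P < j → j < n - P' → q j = 0)
    (hqP : q P ≠ 0) {θ : HT K (In n)} (hθ : θ ∈ ⋀[K]^k (In n → K)) (h0 : θ * w K n n q = 0) :
    ∀ a, a ≤ P → prj K n a (k - a) θ ∈ siegelIdeal K n k := by
  intro a
  induction a using Nat.strong_induction_on with
  | _ a IH =>
  intro haP
  by_cases hak : a ≤ k
  swap
  · rw [prj_eq_zero_of_ne K (by omega) hθ]; exact Submodule.zero_mem _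
  have hexp := mul_w_eq_sum_sum_top K q hθ (k := k)
  rw [h0] at hexp
  have hp := congrArg (prj K n (a + (n - P)) (k - a + P)) hexp
  rw [map_zero, map_sum, Finset.sum_eq_single a] at hp
  · rw [map_sum, Finset.sum_eq_single P] at hp
    · rw [map_smul, prj_of_mem_plane K (mul_w_spike_mem_plane K (by omega) (prj_mem_plane K a (k - a) θ))] at hp
      have hE : prj K n a (k - a) θ * w K n n (fun j => if j = P then (1 : K) else 0) = 0 :=
        (smul_eq_zero.mp hp.symm).resolve_left hqP
      have hker : (⟨prj K n a (k - a) θ, prj_mem_plane K a (k - a) θ⟩ : plane K n a (k - a)) ∈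
          LinearMap.ker (wedgeP K n a (k - a) (fun j => if j = P then (1 : K) else 0)) := by
        rw [LinearMap.mem_ker, wedgeP, LinearMap.comp_apply, Submodule.subtype_apply, LinearMap.mulRight_apply]; exact hE
      rw [ker_wedgeP_of_window_ne K (s := P - a) (by omega) (by rw [if_pos (by omega)]; exact one_ne_zero),
        Submodule.mem_comap, Submodule.subtype_apply, show a + (k - a) = k by omega] at hker
      exact hker
    · intro p hp' hpP
      rw [Finset.mem_range] at hp'
      rw [map_smul]
      by_cases hmid : P < p ∧ p < n - P'
      · rw [hq p hmid.1 hmid.2, zero_smul]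
      · rw [prj_of_mem_plane_ne K (by omega) (mul_w_spike_mem_plane K (by omega) (prj_mem_plane K a (k - a) θ)), smul_zero]
    · intro h; exact absurd (Finset.mem_range.mpr (by omega)) h
  · intro e he hea
    rw [Finset.mem_range] at he
    rw [map_sum]
    refine Finset.sum_eq_zero fun p hp' => ?_
    rw [Finset.mem_range] at hp'
    rw [map_smul]
    by_cases hmid : P < p ∧ p < n - P'
    · rw [hq p hmid.1 hmid.2, zero_smul]
    by_cases hep : e + P = a + p
    · -- a low power with e < a: isotropic by induction (a top power cannot satisfy this: e ≤ k < n − P − P′)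
      have hpP : p ≤ P := by
        by_contra hcon
        have : n - P' ≤ p := by omega
        omega
      have hlt : e < a := by omega
      rw [mul_w_eq_zero_of_mem_siegelIdeal K (IH e hlt (by omega)), map_zero, smul_zero]
    · rw [prj_of_mem_plane_ne K (by omega) (mul_w_spike_mem_plane K (by omega) (prj_mem_plane K e (k - e) θ)), smul_zero]
  · intro h; exact absurd (Finset.mem_range.mpr (by omega)) h

/-- **TOP NODE**: symmetrically, every component `prj (k−b) b θ` with `b ≤ P′` is isotropic. -/
theorem prjY_mem_siegelIdeal_of_two_nodes {k P P' : ℕ} (hkP : k + P + P' + 1 ≤ n) {q : ℕ → K} (hq : ∀ j, P < j → j < n - P' → q j = 0)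
    (hqP' : q (n - P') ≠ 0) {θ : HT K (In n)} (hθ : θ ∈ ⋀[K]^k (In n → K)) (h0 : θ * w K n n q = 0) :
    ∀ b, b ≤ P' → prj K n (k - b) b θ ∈ siegelIdeal K n k := by
  intro b
  induction b using Nat.strong_induction_on with
  | _ b IH =>
  intro hbP
  by_cases hbk : b ≤ k
  swap
  · rw [prj_eq_zero_of_ne K (by omega) hθ]; exact Submodule.zero_mem _
  have hexp := mul_w_eq_sum_sum_top K q hθ (k := k)
  rw [h0] at hexp
  have hp := congrArg (prj K n (k - b + (n - (n - P'))) (k - (k - b) + (n - P'))) hexp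
  rw [map_zero, map_sum, Finset.sum_eq_single (k - b)] at hp
  · rw [map_sum, Finset.sum_eq_single (n - P')] at hp
    · rw [map_smul, prj_of_mem_plane K (mul_w_spike_mem_plane K (by omega) (prj_mem_plane K (k - b) (k - (k - b)) θ))] at hp
      have hE : prj K n (k - b) (k - (k - b)) θ * w K n n (fun j => if j = n - P' then (1 : K) else 0) = 0 :=
        (smul_eq_zero.mp hp.symm).resolve_left hqP'
      rw [show k - (k - b) = b by omega] at hE
      have hker : (⟨prj K n (k - b) b θ, prj_mem_plane K (k - b) b θ⟩ : plane K n (k - b) b) ∈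
          LinearMap.ker (wedgeP K n (k - b) b (fun j => if j = n - P' then (1 : K) else 0)) := by
        rw [LinearMap.mem_ker, wedgeP, LinearMap.comp_apply, Submodule.subtype_apply, LinearMap.mulRight_apply]; exact hE
      rw [ker_wedgeP_of_window_ne K (s := n - P' - (k - b)) (by omega) (by rw [if_pos (by omega)]; exact one_ne_zero),
        Submodule.mem_comap, Submodule.subtype_apply, show (k - b) + b = k by omega] at hker
      exact hker
    · intro p hp' hpP
      rw [Finset.mem_range] at hp'
      rw [map_smul, prj_of_mem_plane_ne K (Or.inr (by omega))
        (mul_w_spike_mem_plane K (by omega) (prj_mem_plane K (k - b) (k - (k - b)) θ)), smul_zero]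
    · intro h; exact absurd (Finset.mem_range.mpr (by omega)) h
  · intro e he hea
    rw [Finset.mem_range] at he
    rw [map_sum]
    refine Finset.sum_eq_zero fun p hp' => ?_
    rw [Finset.mem_range] at hp'
    rw [map_smul]
    by_cases hmid : P < p ∧ p < n - P'
    · rw [hq p hmid.1 hmid.2, zero_smul]
    by_cases hmatch : (k - e) + p = b + (n - P')
    · -- then p is a top power (a low one cannot reach) and the component has fewer than b y-letters
      have hptop : n - P' ≤ p := by
        by_contra hcon
        have : p ≤ P := by omega
        omega
      have hlt : k - e < b := by omega
      have hSI := IH (k - e) hlt (by omega)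
      rw [show k - (k - e) = e by omega] at hSI
      rw [mul_w_eq_zero_of_mem_siegelIdeal K hSI, map_zero, smul_zero]
    · rw [prj_of_mem_plane_ne K (Or.inr (by omega)) (mul_w_spike_mem_plane K (by omega) (prj_mem_plane K e (k - e) θ)),
        smul_zero]
  · intro h; exact absurd (Finset.mem_range.mpr (by omega)) h

/-! ## §36. The two-node confluent kernel law -/

/-- the assembly: such a `θ` lies in `SI_k ⊔ xyRich(k, P, P′)`. -/
theorem mem_sup_of_mul_w_eq_zero_two {k P P' : ℕ} (hkP : k + P + P' + 1 ≤ n) {q : ℕ → K} (hq : ∀ j, P < j → j < n - P' → q j = 0)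
    (hqP : q P ≠ 0) (hqP' : q (n - P') ≠ 0) {θ : HT K (In n)} (hθ : θ ∈ ⋀[K]^k (In n → K)) (h0 : θ * w K n n q = 0) :
    θ ∈ siegelIdeal K n k ⊔ xyRich K n k P P' := by
  rw [← sum_prj K hθ]
  refine Submodule.sum_mem _ fun a ha => ?_
  rw [Finset.mem_range] at ha
  by_cases haP : a ≤ P
  · exact Submodule.mem_sup_left (prj_mem_siegelIdeal_of_two_nodes K hkP hq hqP hθ h0 a haP)
  by_cases hbP : k - a ≤ P'
  · have h := prjY_mem_siegelIdeal_of_two_nodes K hkP hq hqP' hθ h0 (k - a) hbP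
    rw [show k - (k - a) = a by omega] at h
    exact Submodule.mem_sup_left h
  · exact Submodule.mem_sup_right (plane_le_xyRich K (by omega) (by omega) (by omega) (prj_mem_plane K a (k - a) θ))

/-- **THE TWO-NODE CONFLUENT KERNEL LAW: `Kr(univ, w_n(q), k) = SI_k ⊔ xyRich(k, P, P′)`** for `q` supported on `[0, P] ∪ [n − P′, n]` with
`q_P ≠ 0`, `q_{n−P′} ≠ 0` and `k + P + P′ + 1 ≤ n` — the Siegel ideal plus the forms with more than `P` x-letters and more than `P′` y-letters. -/
theorem Kr_w_eq_of_two_orders {k P P' : ℕ} (hkP : k + P + P' + 1 ≤ n) {q : ℕ → K} (hq : ∀ j, P < j → j < n - P' → q j = 0)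
    (hqP : q P ≠ 0) (hqP' : q (n - P') ≠ 0) :
    Kr K Finset.univ (w K n n q) k = siegelIdeal K n k ⊔ xyRich K n k P P' := by
  ext θ
  rw [mem_Kr, KunnethKernel.Hom_univ_eq_exteriorPower]
  constructor
  · rintro ⟨hθ, h0⟩; exact mem_sup_of_mul_w_eq_zero_two K hkP hq hqP hqP' hθ h0
  · intro h
    exact ⟨sup_le (siegelIdeal_le_exteriorPower K k) (xyRich_le_exteriorPower K k P P') h,
      mul_w_eq_zero_of_mem_sup_two K (by omega) hq h⟩

/-- wedge form: `ker(θ ↦ θ ∧ w_n(q) ∣ ⋀^k) = SI_k ⊔ xyRich(k, P, P′)`. -/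
theorem ker_wedge_w_eq_of_two_orders {k P P' : ℕ} (hkP : k + P + P' + 1 ≤ n) {q : ℕ → K} (hq : ∀ j, P < j → j < n - P' → q j = 0)
    (hqP : q P ≠ 0) (hqP' : q (n - P') ≠ 0) :
    LinearMap.ker (Hankel.wedge K n k (w K n n q)) = (siegelIdeal K n k ⊔ xyRich K n k P P').comap (⋀[K]^k (In n → K)).subtype := by
  ext θ
  rw [LinearMap.mem_ker, Submodule.mem_comap, Submodule.subtype_apply, Hankel.wedge, LinearMap.comp_apply,
    Submodule.subtype_apply, LinearMap.mulRight_apply]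
  exact ⟨fun h => mem_sup_of_mul_w_eq_zero_two K hkP hq hqP hqP' θ.2 h, fun h => mul_w_eq_zero_of_mem_sup_two K (by omega) hq h⟩

/-- **THE KERNEL DEPENDS ONLY ON THE TWO ORDERS `(P, P′)`.** -/
theorem Kr_w_eq_Kr_w_of_two_orders {k P P' : ℕ} (hkP : k + P + P' + 1 ≤ n) {q q' : ℕ → K}
    (hq : ∀ j, P < j → j < n - P' → q j = 0) (hqP : q P ≠ 0) (hqP' : q (n - P') ≠ 0)
    (hq' : ∀ j, P < j → j < n - P' → q' j = 0) (hqP2 : q' P ≠ 0) (hqP2' : q' (n - P') ≠ 0) :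
    Kr K Finset.univ (w K n n q) k = Kr K Finset.univ (w K n n q') k := by
  rw [Kr_w_eq_of_two_orders K hkP hq hqP hqP', Kr_w_eq_of_two_orders K hkP hq' hqP2 hqP2']

/-- the Siegel ideal has an x- and a y-letter everywhere: `SI_k ≤ xyRich(k, 0, 0)`. -/
theorem siegelIdeal_le_xyRich_zero (k : ℕ) : siegelIdeal K n k ≤ xyRich K n k 0 0 := by
  rw [siegelIdeal, Submodule.span_le]
  rintro _ ⟨p, rfl⟩
  have h := igen_mem_plane K p
  have hk : (Pof p.1.1).card + 1 + ((Qof p.1.1).card + 1) = k := by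
    have := card_Pof_add_card_Qof p.1.1; have := p.1.2; omega
  rw [show (Qof p.1.1).card + 1 = k - ((Pof p.1.1).card + 1) by omega] at h
  exact plane_le_xyRich K (by omega) (by omega) (by omega) h

/-- **THE PURE CLASS AT `0` PLUS THE POINT: `Kr(univ, w_n(A·δ_0 + c·δ_n), k) = xyRich(k, 0, 0)`** (`A, c ≠ 0`, `k + 1 ≤ n`) — EXACTLY the forms with an
x-letter and a y-letter: gen 13's `F_0(k) ∩ F_∞(k)` (there from the rank of a transverse pair, here from the two-node law). -/
theorem Kr_w_pure_add_point {k : ℕ} (hk : k + 1 ≤ n) {A c : K} (hA : A ≠ 0) (hc : c ≠ 0) :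
    Kr K Finset.univ (w K n n (fun j => if j = 0 then A else if j = n then c else 0)) k = xyRich K n k 0 0 := by
  rw [Kr_w_eq_of_two_orders K (P := 0) (P' := 0) (by omega)
      (fun j hj hj' => by
        show (if j = 0 then A else if j = n then c else 0) = 0
        rw [if_neg (by omega), if_neg (by omega)])
      (by show (if (0 : ℕ) = 0 then A else if (0 : ℕ) = n then c else 0) ≠ 0; rw [if_pos rfl]; exact hA)
      (by
        show (if n - 0 = 0 then A else if n - 0 = n then c else 0) ≠ 0
        rw [Nat.sub_zero, if_neg (by omega), if_pos rfl]; exact hc),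
    sup_eq_right]
  exact siegelIdeal_le_xyRich_zero K k

end Summit.Ventures.HSemireg.Wedge.HankelSiegelIdeal
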